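import Summits.CriticalPhenomena.CardyFormulaZ2.Theorems.CardyComplexConeEdgePrecompactShiftStabilityReduction
import Summits.CriticalPhenomena.CardyFormulaZ2.Theorems.CardyComplexConeEdgePrecompactShiftCouplingLocalityReduction
import Summits.CriticalPhenomena.CardyFormulaZ2.Theorems.CardyComplexConeEdgePrecompactHullStabilityReduction
import Summits.CriticalPhenomena.CardyFormulaZ2.Theorems.CardyComplexConeEdgePrecompactResponseStabilityReduction
import Summits.CriticalPhenomena.CardyFormulaZ2.Theorems.CardyComplexConeEdgePrecompactResponseStabilityUniform
import Summits.CriticalPhenomena.CardyFormulaZ2.Theorems.CardyComplexConeEdgePrecompactTranslationCovariance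
import Summits.CriticalPhenomena.CardyFormulaZ2.Theorems.CardyComplexConeEdgePrecompactEnvelopeFromLocal

/-!
# The X2 chain PER DOMAIN (UFRS at `D` ⇒ shift-coupling locality at `D`)
(line `qkz-strip-boundary-arm` of crux `CardyComplexCone.EdgePrecompact`, stmt-CriticalPhenomena-11387; lead c4;
registered sub-goal `shiftCouplingLocality_at`; consumed by `…EdgePrecompactAtOfX1Ufrs.lean`)

The skeleton's composition `EdgePrecompact_of` feeds the two registered stubs X1 (`stub_localInnerEnvelopeUI`) and
UFRS (`stub_uniformForwardResponseStability`, quantified over ALL Jordan Dobrushin domains) through the landed chain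
`forwardResponseStability_of_uniformForwardResponseStability`, `responseStability_of_forwardResponseStability`,
`hullStability_of_responseStability`, `shiftCouplingLocality_of_hullStability`, `shiftStability_of`,
`equicontClause`, `boundClause`. Every one of these reductions is POINTWISE IN THE DOMAIN (each applies its
hypothesis at the same `D`). This file records the per-domain forms (`…_at`, proofs copied verbatim with `D`
fixed) and the resulting compositions:

* `EdgePrecompact_at_of_X1_of_ufrsAt D : X1 → (UFRS at D) → (EdgePrecompact at D)`;
* `EdgePrecompact_rect_of_X1_of_ufrsRect : X1 → (UFRS for axis-parallel rectangles, the registered sub-goal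
  `ufrs_rect` of wave 3) → (EdgePrecompact for every Dobrushin domain whose carrier is an open axis-parallel
  rectangle)`.

So for rectangles the crux is EXACTLY X1 + `ufrs_rect` (phase-free, RSW/arm technology on a flat boundary);
for general Jordan domains it is X1 + UFRS, whose only non-flat ingredient is the screened collar three-arm
decay `ufrs_screenedCollarDecay` (not in print). X1 itself is research-open and certified hard
(`halfPlaneArm_cubeRoot_of_localInnerEnvelopeUI`).
-/

namespace Summit.CriticalPhenomena.CardyFormulaZ2.Cruxes.EdgePrecompact.QkzStripBoundaryArm

open MeasureTheory Filter Set Metric ProbabilityTheory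
open scoped Topology BigOperators Pointwise
open Literature.Probability.LatticeModels Literature.Probability.Percolation
open Literature.Probability.RandomPlanarGeometry (DobrushinDomain)
open Summit.CriticalPhenomena.CardyFormulaZ2.Theses.CardyComplexCone


noncomputable section

/-! ## The chain, per domain -/
/-- Per-domain form of `forwardResponseStability_of_uniformForwardResponseStability` (UFRS at `D` ⇒ forward response stability at `D`). -/
theorem forwardResponseStability_at (D : DobrushinDomain) :
    (∀ (K : Set ℂ), IsCompact K → K ⊆ D.carrier → ∀ ρ > (0:ℝ), cthickening (2 * ρ) K ⊆ D.carrier → ∀ ε > (0:ℝ), ∃ η > (0:ℝ), ∃ δ₀ > (0:ℝ), ∀ E : DiscreteDobrushin, E.Ω = D.carrier → E.IsZdAdmissible → E.δ < δ₀ → ∀ v w : Site 2, meshPoint E.δ v ∈ K → ‖meshPoint E.δ w‖ < η → (bondPercolation (zdGraph 2) half).real {ω : BondConfig (Site 2) | ¬ ∀ a a' : Site 2 × Fin 4, ((E.IsStartCorner a ∧ (shiftData E w).IsStartCorner a') ∨ (a = a' ∧ medialPoint E.δ (cSrc a) ∈ ball (meshPoint E.δ v) ρ ∧ medialPoint E.δ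 (cTgt a) ∉ ball (meshPoint E.δ v) ρ)) → ∀ n : ℕ, (∀ i < n, medialPoint E.δ (cTgt (cornerOrbit (E.bcBondConfig ω) a i)) ∉ ball (meshPoint E.δ v) ρ ∧ E.IsInnerFace (cFace (cornerOrbit (E.bcBondConfig ω) a (i + 1)))) → medialPoint E.δ (cTgt (cornerOrbit (E.bcBondConfig ω) a n)) ∈ ball (meshPoint E.δ v) ρ → ∃ n' : ℕ, (∀ i < n', medialPoint E.δ (cTgt (cornerOrbit ((shiftData E w).bcBondConfig ω) a' i)) ∉ ball (meshPoint E.δ v) ρ ∧ (shiftData E w).IsInnerFace (cFace (cornerOrbit ((shiftData E w).bcBondConfig ω) a' (i + 1)))) ∧ cornerOrbit ((shiftData E w).bcBondConfig ω) a' n' = cornerOrbit (E.bcBondConfig ω) a n ∧ ∑ i ∈ Finset.range n', turnOf ((shiftData E w).bcBondConfig ω) (cornerOrbit ((shiftData E w).bcBondConfig ω) a' i) = ∑ i ∈ Finset.range n, turnOf (E.bcBondConfig ω) (cornerOrbit (E.bcBondConfig ω) a i)} ≤ ε) →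
    ∀ (Λ : ℝ → DiscreteDobrushin), (∀ δ, (Λ δ).Ω = D.carrier) → (∀ δ, (Λ δ).δ = δ) → (∀ᶠ δ in nhdsWithin (0:ℝ) (Set.Ioi 0), (Λ δ).IsZdAdmissible) → ∀ K : Set ℂ, IsCompact K → K ⊆ D.carrier → ∀ ρ > (0:ℝ), cthickening (2 * ρ) K ⊆ D.carrier → ∀ ε > (0:ℝ), ∃ η > (0:ℝ), ∀ᶠ δ in nhdsWithin (0:ℝ) (Set.Ioi 0), ∀ v f w : Site 2, IsCorner v f → meshPoint δ v ∈ K → ‖meshPoint δ w‖ < η → (bondPercolation (zdGraph 2) half).real {ω : BondConfig (Site 2) | ¬ ∀ a a' : Site 2 × Fin 4, (((Λ δ).IsStartCorner a ∧ (shiftData (Λ δ) w).IsStartCorner a') ∨ (a = a' ∧ medialPoint δ (cSrc a) ∈ ball (meshPoint δ v) ρ ∧ medialPoint δ (cTgt a) ∉ ball (meshPoint δ v) ρ)) → ∀ n : ℕ, (∀ i < n, medialPoint δ (cTgt (cornerOrbit ((Λ δ).bcBondConfig ω) a i)) ∉ ball (meshPoint δ v) ρ ∧ (Λ δ).IsInnerFace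 (cFace (cornerOrbit ((Λ δ).bcBondConfig ω) a (i + 1)))) → medialPoint δ (cTgt (cornerOrbit ((Λ δ).bcBondConfig ω) a n)) ∈ ball (meshPoint δ v) ρ → ∃ n' : ℕ, (∀ i < n', medialPoint δ (cTgt (cornerOrbit ((shiftData (Λ δ) w).bcBondConfig ω) a' i)) ∉ ball (meshPoint δ v) ρ ∧ (shiftData (Λ δ) w).IsInnerFace (cFace (cornerOrbit ((shiftData (Λ δ) w).bcBondConfig ω) a' (i + 1)))) ∧ cornerOrbit ((shiftData (Λ δ) w).bcBondConfig ω) a' n' = cornerOrbit ((Λ δ).bcBondConfig ω) a n ∧ ∑ i ∈ Finset.range n', turnOf ((shiftData (Λ δ) w).bcBondConfig ω) (cornerOrbit ((shiftData (Λ δ) w).bcBondConfig ω) a' i) = ∑ i ∈ Finset.range n, turnOf ((Λ δ).bcBondConfig ω) (cornerOrbit ((Λ δ).bcBondConfig ω) a i)} ≤ ε := by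
  intro hU Λ hΩ hδ hadm K hK hKD ρ hρ hρK ε hε
  obtain ⟨η, hη, δ₀, hδ₀, hE⟩ := hU K hK hKD ρ hρ hρK ε hε
  refine ⟨η, hη, ?_⟩
  have hsmall : ∀ᶠ δ in 𝓝[>] (0:ℝ), δ < δ₀ :=
    (eventually_lt_nhds hδ₀).filter_mono nhdsWithin_le_nhds
  filter_upwards [hadm, hsmall] with δ hadmδ hδs
  intro v f w _ hvK hw
  have key := hE (Λ δ) (hΩ δ) hadmδ (by rw [hδ]; exact hδs) v w (by rw [hδ]; exact hvK)
    (by rw [hδ]; exact hw)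
  simpa only [hδ] using key

/-- Per-domain form of `responseStability_of_forwardResponseStability`. -/
theorem responseStability_at (D : DobrushinDomain) :
    (∀ (Λ : ℝ → DiscreteDobrushin), (∀ δ, (Λ δ).Ω = D.carrier) → (∀ δ, (Λ δ).δ = δ) → (∀ᶠ δ in nhdsWithin (0:ℝ) (Set.Ioi 0), (Λ δ).IsZdAdmissible) → ∀ K : Set ℂ, IsCompact K → K ⊆ D.carrier → ∀ ρ > (0:ℝ), cthickening (2 * ρ) K ⊆ D.carrier → ∀ ε > (0:ℝ), ∃ η > (0:ℝ), ∀ᶠ δ in nhdsWithin (0:ℝ) (Set.Ioi 0), ∀ v f w : Site 2, IsCorner v f → meshPoint δ v ∈ K → ‖meshPoint δ w‖ < η → (bondPercolation (zdGraph 2) half).real {ω : BondConfig (Site 2) | ¬ ∀ a a' : Site 2 × Fin 4, (((Λ δ).IsStartCorner a ∧ (shiftData (Λ δ) w).IsStartCorner a') ∨ (a = a' ∧ medialPoint δ (cSrc a) ∈ ball (meshPoint δ v) ρ ∧ medialPoint δ (cTgt a) ∉ ball (meshPoint δ v) ρ)) → ∀ n : ℕ, (∀ i < n, medialPoint δ (cTgt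 (cornerOrbit ((Λ δ).bcBondConfig ω) a i)) ∉ ball (meshPoint δ v) ρ ∧ (Λ δ).IsInnerFace (cFace (cornerOrbit ((Λ δ).bcBondConfig ω) a (i + 1)))) → medialPoint δ (cTgt (cornerOrbit ((Λ δ).bcBondConfig ω) a n)) ∈ ball (meshPoint δ v) ρ → ∃ n' : ℕ, (∀ i < n', medialPoint δ (cTgt (cornerOrbit ((shiftData (Λ δ) w).bcBondConfig ω) a' i)) ∉ ball (meshPoint δ v) ρ ∧ (shiftData (Λ δ) w).IsInnerFace (cFace (cornerOrbit ((shiftData (Λ δ) w).bcBondConfig ω) a' (i + 1)))) ∧ cornerOrbit ((shiftData (Λ δ) w).bcBondConfig ω) a' n' = cornerOrbit ((Λ δ).bcBondConfig ω) a n ∧ ∑ i ∈ Finset.range n', turnOf ((shiftData (Λ δ) w).bcBondConfig ω) (cornerOrbit ((shiftData (Λ δ) w).bcBondConfig ω) a' i) = ∑ i ∈ Finset.range n, turnOf ((Λ δ).bcBondConfig ω) (cornerOrbit ((Λ δ).bcBondConfig ω) a i)} ≤ ε) →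
    ∀ (Λ : ℝ → DiscreteDobrushin), (∀ δ, (Λ δ).Ω = D.carrier) → (∀ δ, (Λ δ).δ = δ) → (∀ᶠ δ in nhdsWithin (0:ℝ) (Set.Ioi 0), (Λ δ).IsZdAdmissible) → ∀ K : Set ℂ, IsCompact K → K ⊆ D.carrier → ∀ ρ > (0:ℝ), cthickening (2 * ρ) K ⊆ D.carrier → ∀ ε > (0:ℝ), ∃ η > (0:ℝ), ∀ᶠ δ in nhdsWithin (0:ℝ) (Set.Ioi 0), ∀ v f w : Site 2, IsCorner v f → meshPoint δ v ∈ K → ‖meshPoint δ w‖ < η → (bondPercolation (zdGraph 2) half).real {ω : BondConfig (Site 2) | ¬ ∀ a a' : Site 2 × Fin 4, (((Λ δ).IsStartCorner a ∧ (shiftData (Λ δ) w).IsStartCorner a') ∨ (a = a' ∧ medialPoint δ (cSrc a) ∈ ball (meshPoint δ v) ρ ∧ medialPoint δ (cTgt a) ∉ ball (meshPoint δ v) ρ)) → (∀ n : ℕ, (∀ i < n, medialPoint δ (cTgt (cornerOrbit ((Λ δ).bcBondConfig ω) a i)) ∉ ball (meshPoint δ v) ρ ∧ (Λ δ).IsInnerFace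 (cFace (cornerOrbit ((Λ δ).bcBondConfig ω) a (i + 1)))) → medialPoint δ (cTgt (cornerOrbit ((Λ δ).bcBondConfig ω) a n)) ∈ ball (meshPoint δ v) ρ → ∃ n' : ℕ, (∀ i < n', medialPoint δ (cTgt (cornerOrbit ((shiftData (Λ δ) w).bcBondConfig ω) a' i)) ∉ ball (meshPoint δ v) ρ ∧ (shiftData (Λ δ) w).IsInnerFace (cFace (cornerOrbit ((shiftData (Λ δ) w).bcBondConfig ω) a' (i + 1)))) ∧ cornerOrbit ((shiftData (Λ δ) w).bcBondConfig ω) a' n' = cornerOrbit ((Λ δ).bcBondConfig ω) a n ∧ ∑ i ∈ Finset.range n', turnOf ((shiftData (Λ δ) w).bcBondConfig ω) (cornerOrbit ((shiftData (Λ δ) w).bcBondConfig ω) a' i) = ∑ i ∈ Finset.range n, turnOf ((Λ δ).bcBondConfig ω) (cornerOrbit ((Λ δ).bcBondConfig ω) a i)) ∧ (∀ n : ℕ, (∀ i < n, medialPoint δ (cTgt (cornerOrbit ((shiftData (Λ δ) w).bcBondConfig ω) a' i)) ∉ ball (meshPoint δ v) ρ ∧ (shiftData (Λ δ) w).IsInnerFace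 (cFace (cornerOrbit ((shiftData (Λ δ) w).bcBondConfig ω) a' (i + 1)))) → medialPoint δ (cTgt (cornerOrbit ((shiftData (Λ δ) w).bcBondConfig ω) a' n)) ∈ ball (meshPoint δ v) ρ → ∃ n' : ℕ, (∀ i < n', medialPoint δ (cTgt (cornerOrbit ((Λ δ).bcBondConfig ω) a i)) ∉ ball (meshPoint δ v) ρ ∧ (Λ δ).IsInnerFace (cFace (cornerOrbit ((Λ δ).bcBondConfig ω) a (i + 1)))) ∧ cornerOrbit ((Λ δ).bcBondConfig ω) a n' = cornerOrbit ((shiftData (Λ δ) w).bcBondConfig ω) a' n ∧ ∑ i ∈ Finset.range n', turnOf ((Λ δ).bcBondConfig ω) (cornerOrbit ((Λ δ).bcBondConfig ω) a i) = ∑ i ∈ Finset.range n, turnOf ((shiftData (Λ δ) w).bcBondConfig ω) (cornerOrbit ((shiftData (Λ δ) w).bcBondConfig ω) a' i))} ≤ ε := by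
  intro hF Λ hΩ hδ hadm K hK hKD ρ hρ hρK ε hε
  -- a margin `t > 0` with `cthickening (2ρ) (cthickening t K) ⊆ D`
  obtain ⟨t, ht, htD⟩ := (hK.cthickening (r := 2 * ρ)).exists_cthickening_subset_open D.isOpen hρK
  have hK' : IsCompact (cthickening t K) := hK.cthickening
  have hKK' : K ⊆ cthickening t K := self_subset_cthickening K
  have hK'D : cthickening t K ⊆ D.carrier :=
    ((cthickening_subset_of_subset t (self_subset_cthickening K)).trans htD)
  have hρK' : cthickening (2 * ρ) (cthickening t K) ⊆ D.carrier := by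
    rw [cthickening_cthickening (by positivity) ht.le, add_comm, ← cthickening_cthickening ht.le (by positivity)]
    exact htD
  obtain ⟨η₀, hη₀, hev⟩ := hF Λ hΩ hδ hadm (cthickening t K) hK' hK'D ρ hρ hρK' (ε / 2) (half_pos hε)
  refine ⟨min η₀ t, lt_min hη₀ ht, ?_⟩
  filter_upwards [hev] with δ hevδ
  intro v f w hvf hvK hw
  have hwη : ‖meshPoint δ w‖ < η₀ := lt_of_lt_of_le hw (min_le_left _ _)
  have hwt : ‖meshPoint δ w‖ < t := lt_of_lt_of_le hw (min_le_right _ _)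
  have hvK' : meshPoint δ v ∈ cthickening t K := hKK' hvK
  have hv'K' : meshPoint δ (v - w) ∈ cthickening t K := by
    refine mem_cthickening_of_dist_le _ _ _ K hvK ?_
    rw [meshPoint_sub_shift, dist_eq_norm, sub_sub_cancel_left, norm_neg]
    exact hwt.le
  have hvf' : IsCorner (v - w) (f - w) := by
    rw [← isCorner_add_iff (v - w) (f - w) w, sub_add_cancel, sub_add_cancel]; exact hvf
  have hw' : ‖meshPoint δ (-w)‖ < η₀ := by rwa [meshPoint_neg, norm_neg]
  -- the forward bound at `(v, w)` and at `(v - w, -w)`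
  have h₁ := hevδ v f w hvf hvK' hwη
  have h₂ := hevδ (v - w) (f - w) (-w) hvf' hv'K' hw'
  refine le_trans (measureReal_mono ?_) ((measureReal_union_le _ _).trans
    ((add_le_add h₁ ((bondPercolation_real_preimage_shift (-w) half _).le.trans h₂)).trans_eq
      (add_halves ε)))
  -- the event "responses differ" is contained in "forward responses differ" ∪ ("… at (v-w,-w)") - w
  intro ω hω
  by_contra hc
  simp only [Set.mem_union, Set.mem_setOf_eq, Set.mem_preimage, not_or, not_not] at hc
  obtain ⟨hc₁, hc₂⟩ := hc
  apply hω
  intro a a' hpair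
  refine ⟨hc₁ a a' hpair, ?_⟩
  -- the backward clause, read through the translation by `-w`
  generalize hω' : BondConfig.relabel (sym2Equiv (Site.shift (-w))) ω = ω' at hc₂
  have hωeq : ω = BondConfig.relabel (sym2Equiv (Site.shift w)) ω' := by
    rw [← hω']; exact eq_relabel_shift_relabel_neg w ω
  subst hωeq
  obtain ⟨b, rfl⟩ : ∃ b : Site 2 × Fin 4, a' = (b.1 + w, b.2) := ⟨(a'.1 - w, a'.2), by simp⟩
  obtain ⟨b', rfl⟩ : ∃ b' : Site 2 × Fin 4, a = (b'.1 + w, b'.2) := ⟨(a.1 - w, a.2), by simp⟩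
  rw [bcBondConfig_shiftData, bcBondConfig_relabel_shift]
  simp only [cornerOrbit_relabel_shift, cTgt_shift, cFace_shift, turnOf_relabel_shift, shiftCorner_inj,
    medialPoint_shift_mem_ball_iff, isInnerFace_shiftData_iff]
  simp only [isInnerFace_add_iff_shiftData_neg]
  refine hc₂ b b' ?_
  rcases hpair with ⟨h0, h1⟩ | ⟨heq, hs, ht'⟩
  · rw [isStartCorner_shiftData_iff] at h1
    rw [isStartCorner_add_iff_shiftData_neg] at h0
    exact Or.inl ⟨h1, h0⟩
  · rw [shiftCorner_inj] at heq
    subst heq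
    rw [cSrc_shift, medialPoint_shift_mem_ball_iff] at hs
    rw [cTgt_shift, medialPoint_shift_mem_ball_iff] at ht'
    exact Or.inr ⟨rfl, hs, ht'⟩

/-- Per-domain form of `hullStability_of_responseStability`. -/
theorem hullStability_at (D : DobrushinDomain) :
    (∀ (Λ : ℝ → DiscreteDobrushin), (∀ δ, (Λ δ).Ω = D.carrier) → (∀ δ, (Λ δ).δ = δ) → (∀ᶠ δ in nhdsWithin (0:ℝ) (Set.Ioi 0), (Λ δ).IsZdAdmissible) → ∀ K : Set ℂ, IsCompact K → K ⊆ D.carrier → ∀ ρ > (0:ℝ), cthickening (2 * ρ) K ⊆ D.carrier → ∀ ε > (0:ℝ), ∃ η > (0:ℝ), ∀ᶠ δ in nhdsWithin (0:ℝ) (Set.Ioi 0), ∀ v f w : Site 2, IsCorner v f → meshPoint δ v ∈ K → ‖meshPoint δ w‖ < η → (bondPercolation (zdGraph 2) half).real {ω : BondConfig (Site 2) | ¬ ∀ a a' : Site 2 × Fin 4, (((Λ δ).IsStartCorner a ∧ (shiftData (Λ δ) w).IsStartCorner a') ∨ (a = a' ∧ medialPoint δ (cSrc a) ∈ ball (meshPoint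 δ v) ρ ∧ medialPoint δ (cTgt a) ∉ ball (meshPoint δ v) ρ)) → (∀ n : ℕ, (∀ i < n, medialPoint δ (cTgt (cornerOrbit ((Λ δ).bcBondConfig ω) a i)) ∉ ball (meshPoint δ v) ρ ∧ (Λ δ).IsInnerFace (cFace (cornerOrbit ((Λ δ).bcBondConfig ω) a (i + 1)))) → medialPoint δ (cTgt (cornerOrbit ((Λ δ).bcBondConfig ω) a n)) ∈ ball (meshPoint δ v) ρ → ∃ n' : ℕ, (∀ i < n', medialPoint δ (cTgt (cornerOrbit ((shiftData (Λ δ) w).bcBondConfig ω) a' i)) ∉ ball (meshPoint δ v) ρ ∧ (shiftData (Λ δ) w).IsInnerFace (cFace (cornerOrbit ((shiftData (Λ δ) w).bcBondConfig ω) a' (i + 1)))) ∧ cornerOrbit ((shiftData (Λ δ) w).bcBondConfig ω) a' n' = cornerOrbit ((Λ δ).bcBondConfig ω) a n ∧ ∑ i ∈ Finset.range n', turnOf ((shiftData (Λ δ) w).bcBondConfig ω) (cornerOrbit ((shiftData (Λ δ) w).bcBondConfig ω) a' i) = ∑ i ∈ Finset.range n, turnOf ((Λ δ).bcBondConfig ω)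 (cornerOrbit ((Λ δ).bcBondConfig ω) a i)) ∧ (∀ n : ℕ, (∀ i < n, medialPoint δ (cTgt (cornerOrbit ((shiftData (Λ δ) w).bcBondConfig ω) a' i)) ∉ ball (meshPoint δ v) ρ ∧ (shiftData (Λ δ) w).IsInnerFace (cFace (cornerOrbit ((shiftData (Λ δ) w).bcBondConfig ω) a' (i + 1)))) → medialPoint δ (cTgt (cornerOrbit ((shiftData (Λ δ) w).bcBondConfig ω) a' n)) ∈ ball (meshPoint δ v) ρ → ∃ n' : ℕ, (∀ i < n', medialPoint δ (cTgt (cornerOrbit ((Λ δ).bcBondConfig ω) a i)) ∉ ball (meshPoint δ v) ρ ∧ (Λ δ).IsInnerFace (cFace (cornerOrbit ((Λ δ).bcBondConfig ω) a (i + 1)))) ∧ cornerOrbit ((Λ δ).bcBondConfig ω) a n' = cornerOrbit ((shiftData (Λ δ) w).bcBondConfig ω) a' n ∧ ∑ i ∈ Finset.range n', turnOf ((Λ δ).bcBondConfig ω) (cornerOrbit ((Λ δ).bcBondConfig ω) a i) = ∑ i ∈ Finset.range n, turnOf ((shiftData (Λ δ) w).bcBondConfig ω) (cornerOrbit ((shiftData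 (Λ δ) w).bcBondConfig ω) a' i))} ≤ ε) →
    ∀ (Λ : ℝ → DiscreteDobrushin), (∀ δ, (Λ δ).Ω = D.carrier) → (∀ δ, (Λ δ).δ = δ) → (∀ᶠ δ in nhdsWithin (0:ℝ) (Set.Ioi 0), (Λ δ).IsZdAdmissible) → ∀ K : Set ℂ, IsCompact K → K ⊆ D.carrier → ∀ ρ > (0:ℝ), cthickening (2 * ρ) K ⊆ D.carrier → ∀ ε > (0:ℝ), ∃ η > (0:ℝ), ∀ᶠ δ in nhdsWithin (0:ℝ) (Set.Ioi 0), ∀ v f w : Site 2, IsCorner v f → meshPoint δ v ∈ K → ‖meshPoint δ w‖ < η → (bondPercolation (zdGraph 2) half).real {ω : BondConfig (Site 2) | ∃ ω' : BondConfig (Site 2), ω' \ {e | medialPoint δ e ∈ ball (meshPoint δ v) ρ} = ω \ {e | medialPoint δ e ∈ ball (meshPoint δ v) ρ} ∧ ¬ ∀ W : ℝ, (∃ k : ℕ, (medialExploration (Λ δ) ω')[k]? = some (cornerSource v f) ∧ (medialExploration (Λ δ) ω')[k + 1]? = some (cornerTarget v f) ∧ Polyline.winding (((medialExploration (Λ δ)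 ω').map (medialPoint δ)).take (k + 2)) = W) ↔ (∃ k : ℕ, (medialExploration (shiftData (Λ δ) w) ω')[k]? = some (cornerSource v f) ∧ (medialExploration (shiftData (Λ δ) w) ω')[k + 1]? = some (cornerTarget v f) ∧ Polyline.winding (((medialExploration (shiftData (Λ δ) w) ω').map (medialPoint δ)).take (k + 2)) = W)} ≤ ε := by
  intro hRS Λ hΩ hδ hadm K hK hKD ρ hρ hρK ε hε
  obtain ⟨η, hη, hev⟩ := hRS Λ hΩ hδ hadm K hK hKD ρ hρ hρK ε hε
  refine ⟨min η (ρ / 4), lt_min hη (by positivity), ?_⟩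
  -- the bulk of `D`: eventually every lattice point of `cthickening (3ρ/2) K` lies in `Ω_δ`
  have hK' : IsCompact (cthickening (3 * ρ / 2) K) := hK.cthickening
  have hK'D : cthickening (3 * ρ / 2) K ⊆ D.carrier :=
    (cthickening_mono (by linarith) K).trans hρK
  have hbulk := D.toJordanDomain.eventually_forall_mem_meshDomain' hK' hK'D
  have hsmall : ∀ᶠ δ in 𝓝[>] (0:ℝ), δ < ρ / 56 :=
    (eventually_lt_nhds (by positivity)).filter_mono nhdsWithin_le_nhds
  have hpos : ∀ᶠ δ in 𝓝[>] (0:ℝ), 0 < δ := eventually_mem_nhdsWithin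
  filter_upwards [hev, hadm, hbulk, hsmall, hpos] with δ hevδ hadmδ hbulkδ hδs hδp
  intro v f w hvf hvK hw
  have hwη : ‖meshPoint δ w‖ < η := lt_of_lt_of_le hw (min_le_left _ _)
  have hwρ : ‖meshPoint δ w‖ < ρ / 4 := lt_of_lt_of_le hw (min_le_right _ _)
  have hΛδ : (Λ δ).δ = δ := hδ δ
  -- every lattice edge at a site within `ρ + ρ/4 + 10δ` of `δv` is an edge of `Ω_δ`
  have hM : ∀ x y : Site 2, dist (meshPoint δ x) (meshPoint δ v) < ρ + ρ / 4 + 10 * δ →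
      (zdGraph 2).Adj x y → (discreteDomainGraph D.carrier δ).Adj x y := by
    intro x y hx hxy
    obtain ⟨k, rfl⟩ := exists_eq_add_cornerUnit hxy
    have hy : dist (meshPoint δ (x + cornerUnit k)) (meshPoint δ v) < ρ + ρ / 4 + 14 * δ := by
      have h1 := dist_meshPoint_add_cornerUnit_le hδp.le x k
      have h2 := dist_triangle (meshPoint δ (x + cornerUnit k)) (meshPoint δ x) (meshPoint δ v)
      linarith
    have hin : ∀ u : Site 2, dist (meshPoint δ u) (meshPoint δ v) < ρ + ρ / 4 + 14 * δ →
        u ∈ meshDomain D.carrier δ := fun u hu =>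
      hbulkδ.1 u (mem_cthickening_of_dist_le _ _ _ K hvK (by linarith))
    have hball : ∀ u : Site 2, dist (meshPoint δ u) (meshPoint δ v) < ρ + ρ / 4 + 14 * δ →
        meshPoint δ u ∈ closedBall (meshPoint δ v) (ρ + ρ / 4 + 14 * δ) := fun u hu =>
      mem_closedBall.2 hu.le
    rw [discreteDomainGraph_adj_iff, meshGraph_adj_iff]
    refine ⟨⟨hxy, ?_⟩, hin x (by linarith), hin _ hy⟩
    refine ((convex_closedBall _ _).segment_subset (hball x (by linarith)) (hball _ hy)).trans ?_
    refine Set.Subset.trans (fun u hu => ?_) subset_closure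
    exact hρK (mem_cthickening_of_dist_le u (meshPoint δ v) (2 * ρ) K hvK
      (by have := mem_closedBall.1 hu; linarith))
  -- depth of the two data around the ball
  have hdeep₀ : ∀ x y : Site 2, dist (meshPoint δ x) (meshPoint δ v) < ρ + 10 * δ →
      (zdGraph 2).Adj x y → (discreteDomainGraph (Λ δ).Ω (Λ δ).δ).Adj x y := fun x y hx hxy => by
    rw [hΩ, hΛδ]
    exact hM x y (by linarith) hxy
  have hdeep₁ : ∀ x y : Site 2, dist (meshPoint δ x) (meshPoint δ v) < ρ + 10 * δ →
      (zdGraph 2).Adj x y →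
      (discreteDomainGraph (shiftData (Λ δ) w).Ω (shiftData (Λ δ) w).δ).Adj x y := by
    intro x y hx hxy
    have key : (discreteDomainGraph (Λ δ).Ω (Λ δ).δ).Adj (x - w) (y - w) := by
      rw [hΩ, hΛδ]
      refine hM _ _ ?_ ((zdGraph_adj_shift_iff w (x - w) (y - w)).1 (by simpa only [Site.shift_apply, sub_add_cancel] using hxy))
      have hsub : meshPoint δ (x - w) = meshPoint δ x - meshPoint δ w :=
        eq_sub_of_add_eq (by rw [add_comm, ← meshPoint_add_shift, sub_add_cancel])
      rw [hsub]
      calc dist (meshPoint δ x - meshPoint δ w) (meshPoint δ v)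
          ≤ dist (meshPoint δ x - meshPoint δ w) (meshPoint δ x) + dist (meshPoint δ x) (meshPoint δ v) :=
            dist_triangle _ _ _
        _ = ‖meshPoint δ w‖ + dist (meshPoint δ x) (meshPoint δ v) := by
            rw [dist_eq_norm]; congr 1; simp
        _ < ρ + ρ / 4 + 10 * δ := by linarith
    have := (adj_shiftData_iff (Λ δ) w (x - w) (y - w)).2 key
    simpa only [sub_add_cancel] using this
  -- the event of hull stability is contained in "responses differ"
  refine le_trans (measureReal_mono ?_) (hevδ v f w hvf hvK hwη)
  rintro ω ⟨ω', hωω', hdis⟩ hgood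
  apply hdis
  obtain ⟨j, rfl⟩ := exists_faceAt_of_isCorner hvf
  rw [show cornerSource v (faceAt v j) = cSrc (v, j) from cornerSource_cFace (v, j),
    show cornerTarget v (faceAt v j) = cTgt (v, j) from cornerTarget_cFace (v, j)]
  have hδρ : δ < ρ := by linarith
  have hps : medialPoint δ (cSrc (v, j)) ∈ ball (meshPoint δ v) ρ :=
    mem_ball.2 (lt_of_le_of_lt (dist_medialPoint_cSrc_le' hδp.le (v, j)) hδρ)
  have hpt : medialPoint δ (cTgt (v, j)) ∈ ball (meshPoint δ v) ρ :=
    mem_ball.2 (lt_of_le_of_lt (dist_medialPoint_cTgt_le' hδp.le (v, j)) hδρ)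
  have h₀ := bcBondConfig_agree_off (E := Λ δ) hωω'
  have h₁ := bcBondConfig_agree_off (E := shiftData (Λ δ) w) hωω'
  exact passageAgree_of_response (Λ δ) (shiftData (Λ δ) w) δ (meshPoint δ v) ρ (ρ + 10 * δ) hadmδ
    (isZdAdmissible_shiftData _ _ hadmδ) hΛδ hΛδ le_rfl hdeep₀ hdeep₁ ω' (v, j) hps hpt
    (fun c₀ c₁ hc₀ hc₁ => ⟨response_transfer h₀ h₁ _ _ c₀ c₁ (hgood c₀ c₁ (Or.inl ⟨hc₀, hc₁⟩)).1,
      response_transfer h₁ h₀ _ _ c₁ c₀ (hgood c₀ c₁ (Or.inl ⟨hc₀, hc₁⟩)).2⟩)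
    (fun q hq hq' => ⟨response_transfer h₀ h₁ _ _ q q (hgood q q (Or.inr ⟨rfl, hq, hq'⟩)).1,
      response_transfer h₁ h₀ _ _ q q (hgood q q (Or.inr ⟨rfl, hq, hq'⟩)).2⟩)

/-- Per-domain form of `shiftCouplingLocality_of_hullStability`. -/
theorem shiftCouplingLocality_at : ∀ (D : DobrushinDomain),
    (∀ (Λ : ℝ → DiscreteDobrushin), (∀ δ, (Λ δ).Ω = D.carrier) → (∀ δ, (Λ δ).δ = δ) → (∀ᶠ δ in nhdsWithin (0:ℝ) (Set.Ioi 0), (Λ δ).IsZdAdmissible) → ∀ K : Set ℂ, IsCompact K → K ⊆ D.carrier → ∀ ρ > (0:ℝ), cthickening (2 * ρ) K ⊆ D.carrier → ∀ ε > (0:ℝ), ∃ η > (0:ℝ), ∀ᶠ δ in nhdsWithin (0:ℝ) (Set.Ioi 0), ∀ v f w : Site 2, IsCorner v f → meshPoint δ v ∈ K → ‖meshPoint δ w‖ < η → (bondPercolation (zdGraph 2) half).real {ω : BondConfig (Site 2) | ∃ ω' : BondConfig (Site 2), ω' \ {e | medialPoint δ e ∈ ball (meshPoint δ v) ρ} =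 ω \ {e | medialPoint δ e ∈ ball (meshPoint δ v) ρ} ∧ ¬ ∀ W : ℝ, (∃ k : ℕ, (medialExploration (Λ δ) ω')[k]? = some (cornerSource v f) ∧ (medialExploration (Λ δ) ω')[k + 1]? = some (cornerTarget v f) ∧ Polyline.winding (((medialExploration (Λ δ) ω').map (medialPoint δ)).take (k + 2)) = W) ↔ (∃ k : ℕ, (medialExploration (shiftData (Λ δ) w) ω')[k]? = some (cornerSource v f) ∧ (medialExploration (shiftData (Λ δ) w) ω')[k + 1]? = some (cornerTarget v f) ∧ Polyline.winding (((medialExploration (shiftData (Λ δ) w) ω').map (medialPoint δ)).take (k + 2)) = W)} ≤ ε) →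
    ∀ (Λ : ℝ → DiscreteDobrushin), (∀ δ, (Λ δ).Ω = D.carrier) → (∀ δ, (Λ δ).δ = δ) → (∀ᶠ δ in nhdsWithin (0:ℝ) (Set.Ioi 0), (Λ δ).IsZdAdmissible) → ∀ K : Set ℂ, IsCompact K → K ⊆ D.carrier → ∀ ρ > (0:ℝ), cthickening (2 * ρ) K ⊆ D.carrier → ∀ ε > (0:ℝ), ∃ η > (0:ℝ), ∀ᶠ δ in nhdsWithin (0:ℝ) (Set.Ioi 0), ∀ v f w : Site 2, IsCorner v f → meshPoint δ v ∈ K → ‖meshPoint δ w‖ < η → ∃ B : Set (BondConfig (Site 2)), MeasurableSet[MeasurableSpace.comap (fun ω : BondConfig (Site 2) => ω \ {e | medialPoint δ e ∈ ball (meshPoint δ v) ρ}) (inferInstance : MeasurableSpace (BondConfig (Site 2)))] B ∧ (bondPercolation (zdGraph 2) half).real B ≤ ε ∧ (∫ ω, dartPhaseSum (medialExploration (Λ δ) ω) δ (1 / 3) (v, f) ∂(bondPercolation (zdGraph 2) half)) - (∫ ω, dartPhaseSum (medialExploration (shiftData (Λ δ) w) ω) δ (1 / 3) (v, f) ∂(bondPercolation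 (zdGraph 2) half)) = (∫ ω in B, dartPhaseSum (medialExploration (Λ δ) ω) δ (1 / 3) (v, f) ∂(bondPercolation (zdGraph 2) half)) - (∫ ω in B, dartPhaseSum (medialExploration (shiftData (Λ δ) w) ω) δ (1 / 3) (v, f) ∂(bondPercolation (zdGraph 2) half)) := by
  intro D hHS Λ hΩ hδ hadm K hK hKD ρ hρ hρK ε hε
  obtain ⟨η, hη, hev⟩ := hHS Λ hΩ hδ hadm K hK hKD ρ hρ hρK ε hε
  refine ⟨η, hη, ?_⟩
  filter_upwards [hev, hadm] with δ hevδ hadmδ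
  intro v f w hvf hvK hw
  have hPB := hevδ v f w hvf hvK hw
  -- the interior pairs of the ball and the disagreement property
  set I : Set (Sym2 (Site 2)) := {e | medialPoint δ e ∈ ball (meshPoint δ v) ρ} with hI_def
  set Dis : BondConfig (Site 2) → Prop := fun ω' => ¬ ∀ W : ℝ,
      (∃ k : ℕ, (medialExploration (Λ δ) ω')[k]? = some (cornerSource v f) ∧
          (medialExploration (Λ δ) ω')[k + 1]? = some (cornerTarget v f) ∧
          Polyline.winding (((medialExploration (Λ δ) ω').map (medialPoint δ)).take (k + 2)) = W) ↔
        (∃ k : ℕ, (medialExploration (shiftData (Λ δ) w) ω')[k]? = some (cornerSource v f) ∧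
          (medialExploration (shiftData (Λ δ) w) ω')[k + 1]? = some (cornerTarget v f) ∧
          Polyline.winding (((medialExploration (shiftData (Λ δ) w) ω').map (medialPoint δ)).take (k + 2)) = W)
    with hDis_def
  -- the finitely many edges read by the two explorations
  have hadm₁ : (shiftData (Λ δ) w).IsZdAdmissible := isZdAdmissible_shiftData _ _ hadmδ
  set A : Set (Sym2 (Site 2)) := (discreteDomainGraph (Λ δ).Ω (Λ δ).δ).edgeSet ∪
    (discreteDomainGraph (shiftData (Λ δ) w).Ω (shiftData (Λ δ) w).δ).edgeSet with hA_def
  have hAfin : A.Finite :=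
    (finite_edgeSet_discreteDomainGraph hadmδ.isBounded hadmδ.delta_pos).union
      (finite_edgeSet_discreteDomainGraph hadm₁.isBounded hadm₁.delta_pos)
  have hmE₀ : ∀ ω, medialExploration (Λ δ) (ω ∩ A) = medialExploration (Λ δ) ω := fun ω =>
    medialExploration_inter_eq (Λ δ) (by rw [hA_def]; exact subset_union_left) ω
  have hmE₁ : ∀ ω, medialExploration (shiftData (Λ δ) w) (ω ∩ A) =
      medialExploration (shiftData (Λ δ) w) ω := fun ω =>
    medialExploration_inter_eq (shiftData (Λ δ) w) (by rw [hA_def]; exact subset_union_right) ω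
  have hDisA : ∀ ω, Dis ω ↔ Dis (ω ∩ A) := fun ω => by
    simp only [hDis_def]
    rw [hmE₀ ω, hmE₁ ω]
  -- the event: exterior projection of the passage-disagreement set
  refine ⟨{ω | ∃ ω', ω' \ I = ω \ I ∧ Dis ω'}, measurableSet_comap_exteriorProjection hAfin hDisA I,
    hPB, ?_⟩
  refine integral_sub_eq_setIntegral_sub
    (integrable_dartPhaseSum_medialExploration hadmδ δ (1 / 3) (v, f))
    (integrable_dartPhaseSum_medialExploration hadm₁ δ (1 / 3) (v, f))
    (measurableSet_exteriorProjection hAfin hDisA I) fun ω hω => ?_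
  -- off the event the passages agree (take `ω' = ω`), hence so do the phase sums
  exact dartPhaseSum_eq_of_passage_iff (nodup_zip_tail_medialExploration _ _)
    (nodup_zip_tail_medialExploration _ _) δ (1 / 3) (v, f)
    (not_not.1 fun hcon => hω ⟨ω, rfl, hcon⟩)


end

end Summit.CriticalPhenomena.CardyFormulaZ2.Cruxes.EdgePrecompact.QkzStripBoundaryArm
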